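import Literature.AlgebraicGeometry.HodgeTheory.SemiregularityHigherSigma
import Mathlib.Order.UpperLower.Basic
import HarnessLib

/-!
# Venture HSemireg — untwisting by a line bundle preserves FULL semiregularity (route R1.0, the kernel
# clause of the μ₂-gerbe untwisting step, on the tree's real carriers `σ_q`)

HONEST FRAMING. Pure algebra plus its instantiation on the tree's REAL Buchweitz–Flenner components
`σ_q = sigmaHigher hE q : Ext²(E, E) → H^{q+2}(X, Ω^q_{X/S})` (`HodgeTheory/SemiregularityHigherSigma.lean`).
Nothing is asserted about any explicit variety, no gerbe is constructed, and nothing here says HC, HC_CM or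
HC_AV is proved. Every geometric input of route R1.0 enters as an explicit HYPOTHESIS of a theorem (never as
a named fact): this file proves exactly the bookkeeping that turns those inputs into «full semiregularity is
preserved», and proves that the bookkeeping FAILS for a single component.

## The step being served (cell pub-hsemireg, `general-structure/PERRY-SUBSTITUTE-GS.md` §1 (R1.0), §6, §8–§9;
## th-1 `theory/TH1-PERRY-RESIDUE.md` §4 «(T)»; gs-red RED-GS.md GS-23(a)(b))

Setting of R1.0, by value (the numbers are the cell's refereed STEP-0 (C) data, quoted for orientation only —
they are NOT hypotheses or conclusions of anything in this file): `X₀ = X × X̂` an abelian fourfold (`X = E×E`,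
`E` CM), `P` the Poincaré bundle, `E₀ = Φ(I_p ⊠ I_q)` a perfect complex of amplitude `[-1, 0]` with
`Ext^{<0}(E₀, E₀) = 0`, `dim Ext²_{X₀}(E₀, E₀) = 18`, target `⊕_q H^{q+2}(X₀, Ω^q)` of dimension `28`, FULL
`σ_{E₀}` injective; B-field `B₀ = c₁(P)/2`, Brauer class of order exactly `2` on the general fibre of the Weil
family. THE TWIST: `π : 𝔊₀ → X₀` the `μ₂`-gerbe of square roots of `P` (class `c₁(P) mod 2 ∈ H²_ét(X₀, μ₂)`),
`L` the tautological root (`L² = π^*P`, `c₁(L) = c₁(P)/2`), `E₀′ := π^*E₀ ⊗ L^{∓1}`. R1.0 makes three claims: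
(R1.0.i) `Ext•_{𝔊₀}(E₀′, E₀′) = Ext•_{X₀}(E₀, E₀)` (`π` cohomologically affine, weight bookkeeping);
(R1.0.ii) `ch(E₀′) = κ(E₀) := exp(-c₁(E₀)/rk) · ch(E₀)`; (R1.0.iii) `σ_{E₀′} = exp(∓c₁(L)) ∪ σ_{E₀}`, «hence
injective iff `σ_{E₀}` is». gs-red GS-23(b): (iii) holds for the FULL map only — the multiplier `exp(∓c₁(L)) ∪`
is unipotent and MIXES the components, so «a single `σ_q` is NOT transported». th-1 (T): the same for Pridham's
`𝓛`, from the Leibniz rule `At(F ⊗ M) = At(F) ⊗ 1 + 1 ⊗ At(M)` (`M` a line bundle, `At(M) = c₁(M)` central).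

## What is PROVED here (0 sorry, 0 named facts, no new definitions)

Write `σ_q : A → W_q`, `σ′_q : A′ → W′_q` (`q ∈ ℕ`) for two families of additive maps, `θ : A → A′` additive,
and call `(σ_q)_{q ∈ I}` JOINTLY INJECTIVE when `(∀ q ∈ I, σ_q x = 0) → x = 0` — for `σ_q = sigmaHigher hE q`
this is literally `IsISemiregular hE I` (`isISemiregular_iff`, `Iff.rfl`).

* `forall_mem_apply_eq_zero_iff_of_isLowerSet` — the core: if for every `q` and `x` the vanishing of the LOWER
  components `σ_j x` (`j < q`) makes `σ′_q (θ x) = 0 ⟺ σ_q x = 0`, then for every LOWER SET `I ⊆ ℕ`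
  (`IsLowerSet I`: `Set.univ` = the FULL map, `Set.Iio p = {q | q < p}` = the p-adic notion, `Set.Iic n`, `∅`)
  `(∀ q ∈ I, σ′_q (θ x) = 0) ⟺ (∀ q ∈ I, σ_q x = 0)` (strong induction inside `I`).
* `apply_eq_zero_iff_of_triangular` — the hypothesis of the core holds whenever
  `σ′_q (θ x) = d_q (σ_q x) + Σ_{j<q} u_{q,j} (σ_j x)` with `d_q` INJECTIVE («triangular re-expansion with
  injective diagonal»; `u_{q,j} : W_j → W′_q` ARBITRARY additive maps). This is the shape produced by the Leibniz
  rule: with the tree's normalisation `σ_q(ξ) = Tr(ξ · At^q)` and `At(F ⊗ M) = At(F) ⊗ 1 + 1 ⊗ c₁(M)`,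
  `σ_q^{F⊗M}(ξ ⊗ 1) = Σ_{j ≤ q} (q choose j) · (c₁(M)^{q-j} ∪ σ_j^F(ξ))` up to the sign conventions of the
  wedge — diagonal `d_q = id` (or `π^*` when `F ⊗ M` lives on the gerbe / an étale chart), `u_{q,j} =
  ± (q choose j) · (c₁(M)^{q-j} ∪ –)`; in BF's normalisation `σ = Tr(∗ · exp(-At))` the multiplier is
  `exp(∓c₁(M)) ∪` (th-1 (T)). Injective diagonals also absorb rescalings `(-1)^q/q!` (where invertible) and
  changes of coefficient carrier.
* `jointlyInjective_iff_of_triangular` (+ the one-sided `…_of_surjective` / `…_of_injective`) — joint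
  injectivity on a lower set `I` passes back and forth along `θ` (bijective, resp. surjective / injective).
* ON THE REAL CARRIERS: `isISemiregular_iff_of_triangular` — for `E` finite locally free on `X/S` and `E′`
  finite locally free on `X′/S′`, an additive bijection `θ : Ext²(E, E) ≃+ Ext²(E′, E′)`, injective
  `d_q : H^{q+2}(X, Ω^q) →+ H^{q+2}(X′, Ω^q)` and arbitrary `u_{q,j}` with
  `σ_q^{E′}(θ ξ) = d_q (σ_q^E ξ) + Σ_{j<q} u_{q,j} (σ_j^E ξ)` for `q ∈ I`:
  **`IsISemiregular hE I ↔ IsISemiregular hE′ I` for every lower set `I`**; the FULL map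
  (`isISemiregular_univ_iff_of_triangular` — the R1.0 (iii) / (T) clause «`σ_{E₀′}` injective iff `σ_{E₀}`
  is»; one-sided with `θ` merely surjective: `isISemiregular_univ_of_triangular_of_surjective`), the p-adic
  part (`isISemiregular_Iio_iff_of_triangular`), the same-scheme unitriangular case
  (`isISemiregular_iff_of_unitriangular`, `d_q = id`), and the one-sided transports.
* THE CAVEAT AS A THEOREM: `exists_unitriangular_not_transporting_singleton` — an explicit unitriangular
  re-expansion over `ℤ` (`σ_q = id` for all `q`; `u_{1,0} = -id`, all other `u = 0`; so `σ′_1 = 0`) under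
  which `{1}`-injectivity holds for `σ` and fails for `σ′`: «lower set» cannot be dropped, i.e. a single
  `σ_q` / `IsHigherSemiregular` is NOT transported by untwisting (gs-red GS-23(b)).

## How R1.0 maps onto the hypotheses (what is NOT proved here, and where it is printed)

* `θ` = (R1.0.i), `ξ ↦ π^*ξ ⊗ 1_L : Ext²_{X₀}(E₀, E₀) ⥲ Ext²_{𝔊₀}(E₀′, E₀′)` (gs-red GS-23(a): `π`
  cohomologically affine, `π_* π^* = id` on weight `0`; `- ⊗ L` an autoequivalence). In the UNTWISTED reading
  of the STEP-0 component (p1 UNTWIST-p1 (V3′), lead R-49(a)/R-51(a): `E′ = E₀ ⊗ M_B` on `X₀` itself,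
  `c₁(M_B) = (h_B + c₁(P))/2`) `θ = (- ⊗ 1_{M_B})`, `X′ = X`, `d_q = id`. NOT constructed here: the tree has no
  line-bundle twist functor with unitors on `X.Modules` and no gerbe (cell memos th-2
  TH2-PERRY-ASSEMBLY-TYPABILITY K2/K5, gs-g4 G4-SUMMARY).
* `d_q` = `π^* : H^{q+2}(X₀, Ω^q) → H^{q+2}(𝔊₀, Ω^q)`, an isomorphism for the tame gerbe (lit-1
  GERBE-SCOPE-LOCATORS (L2)/(L3): `π_*` exact, `π_* 𝒪_𝔊 = 𝒪_X`, `Ω_𝔊 = π^*Ω_X`); only injectivity is used.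
* `hσ` = the Leibniz rule for the Atiyah class of a tensor product with a line bundle: Atiyah 1957, Prop. 10
  (extensions) and Prop. 11 «`b(E ⊗ E′) = b(E) ⊗ I′ + I ⊗ b(E′)`» (Trans. AMS 85, p. 196, READ: held text
  p0015 L85–p0016 L12) [Atiyah1957]; for complexes Markman, arXiv:2502.03415, «`at_𝓑 = at_𝓔 ⊗ id_𝓛 + id_𝓔 ⊗ at_𝓛`»
  [Markman2025SecantWeil]; Buchweitz–Flenner 2003 §3–§4 (functoriality of `At`, the algebra `A`, traces
  compatible with cup products) [BuchweitzFlenner2003]. With `At(M) = c₁(M)` central the binomial expansion of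
  `(At(F) ⊗ 1 + 1 ⊗ c₁(M))^q` and `Tr((ξ ⊗ 1) · –) = – ∪ Tr(ξ · –)` give the displayed triangular formula.
* (R1.0.ii) (`ch(E₀′) = κ(E₀)`) is class bookkeeping in `H^{2•}(X₀, ℚ)` and does not concern `σ`; not here.

## References

* R.-O. Buchweitz, H. Flenner, *A semiregularity map for modules and applications to deformations*,
  Compositio Math. 137 (2003), §4 Def. 4.1 (`σ = Tr(∗ · exp(-At))`), §5 (`I`-semiregular). [BuchweitzFlenner2003]
* M. F. Atiyah, *Complex analytic connections in fibre bundles*, Trans. AMS 85 (1957), Prop. 10, Prop. 11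
  (p. 196). [Atiyah1957]
* E. Markman, *Cycles on abelian 2n-folds of Weil type from secant sheaves on abelian n-folds*,
  arXiv:2502.03415 (preprint; the Atiyah class of `𝓔 ⊗ 𝓛`). [Markman2025SecantWeil]
* J. P. Pridham, *Semiregularity as a consequence of Goodwillie's theorem*, Forum Math. Sigma 12 (2024) e126,
  Cor. 2.25, Rem. 2.26 (μ_r-gerbes), Rem. 2.27. [Pridham2024Semiregularity]
-/

open CategoryTheory CategoryTheory.Abelian AlgebraicGeometry

namespace Summit.Ventures.HSemireg

/-! ### Triangular transport of joint injectivity (pure algebra) -/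

section TriangularTransport

variable {A A' : Type*} [AddCommGroup A] [AddCommGroup A'] {W W' : ℕ → Type*}
  [∀ q, AddCommGroup (W q)] [∀ q, AddCommGroup (W' q)]
  {σ : ∀ q, A →+ W q} {σ' : ∀ q, A' →+ W' q}

/-- **Core: lower-set vanishing is transported by a kernel-triangular comparison.** If for every `q`
and `x`, once the lower components `σ_j x` (`j < q`) vanish one has `σ′_q (θ x) = 0 ↔ σ_q x = 0`, then for
every LOWER set `I ⊆ ℕ` the simultaneous vanishing of `(σ′_q (θ x))_{q ∈ I}` is equivalent to that of
`(σ_q x)_{q ∈ I}` (strong induction on `q` inside `I`). [folklore] -/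
theorem forall_mem_apply_eq_zero_iff_of_isLowerSet (θ : A →+ A')
    (hker : ∀ (q : ℕ) (x : A), (∀ j < q, σ j x = 0) → (σ' q (θ x) = 0 ↔ σ q x = 0))
    {I : Set ℕ} (hI : IsLowerSet I) (x : A) :
    (∀ q ∈ I, σ' q (θ x) = 0) ↔ ∀ q ∈ I, σ q x = 0 := by
  refine ⟨fun h q => ?_, fun h q hq => (hker q x fun j hj => h j (hI hj.le hq)).2 (h q hq)⟩
  induction q using Nat.strong_induction_on with
  | _ q ih => exact fun hq => (hker q x fun j hj => ih j hj (hI hj.le hq)).1 (h q hq)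

/-- **A triangular re-expansion with injective diagonal is kernel-triangular**: if
`σ′_q (θ x) = d_q (σ_q x) + Σ_{j<q} u_{q,j} (σ_j x)` with `d_q` injective, then once the lower components
`σ_j x` (`j < q`) vanish, `σ′_q (θ x) = 0 ↔ σ_q x = 0` — whatever the mixing maps `u_{q,j}` are. (The shape
produced by `At(F ⊗ M) = At(F) ⊗ 1 + 1 ⊗ c₁(M)`: `u_{q,j} = ±(q choose j) · (c₁(M)^{q-j} ∪ –)`, `d_q = id`
or `π^*`.) [folklore] -/
theorem apply_eq_zero_iff_of_triangular (θ : A →+ A') (d : ∀ q, W q →+ W' q)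
    (u : ∀ q j, W j →+ W' q) {q : ℕ} (hd : Function.Injective (d q)) (x : A)
    (hσ : σ' q (θ x) = d q (σ q x) + ∑ j ∈ Finset.range q, u q j (σ j x))
    (hlow : ∀ j < q, σ j x = 0) : σ' q (θ x) = 0 ↔ σ q x = 0 := by
  rw [hσ, Finset.sum_eq_zero fun j hj => by rw [hlow j (Finset.mem_range.mp hj), map_zero], add_zero]
  exact map_eq_zero_iff (d q) hd

/-- **Lower-set vanishing under a triangular re-expansion with injective diagonal** (the core with the
hypothesis in formula form, required only for `q ∈ I`). [folklore] -/
theorem forall_mem_apply_eq_zero_iff_of_triangular (θ : A →+ A') (d : ∀ q, W q →+ W' q)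
    (u : ∀ q j, W j →+ W' q) {I : Set ℕ} (hI : IsLowerSet I)
    (hd : ∀ q ∈ I, Function.Injective (d q))
    (hσ : ∀ q ∈ I, ∀ x : A, σ' q (θ x) = d q (σ q x) + ∑ j ∈ Finset.range q, u q j (σ j x)) (x : A) :
    (∀ q ∈ I, σ' q (θ x) = 0) ↔ ∀ q ∈ I, σ q x = 0 := by
  refine ⟨fun h q => ?_, fun h q hq => ?_⟩
  · induction q using Nat.strong_induction_on with
    | _ q ih =>
      exact fun hq => (apply_eq_zero_iff_of_triangular θ d u (hd q hq) x (hσ q hq x)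
        fun j hj => ih j hj (hI hj.le hq)).1 (h q hq)
  · exact (apply_eq_zero_iff_of_triangular θ d u (hd q hq) x (hσ q hq x)
      fun j hj => h j (hI hj.le hq)).2 (h q hq)

/-- **Joint injectivity descends along a surjective comparison**: if `(σ_q)_{q ∈ I}` is jointly injective
on `A`, `θ : A → A′` is surjective and `σ′` is a triangular re-expansion of `σ` through `θ` with injective
diagonal on the lower set `I`, then `(σ′_q)_{q ∈ I}` is jointly injective on `A′`. [folklore] -/
theorem jointlyInjective_of_triangular_of_surjective (θ : A →+ A') (hθ : Function.Surjective θ)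
    (d : ∀ q, W q →+ W' q) (u : ∀ q j, W j →+ W' q) {I : Set ℕ} (hI : IsLowerSet I)
    (hd : ∀ q ∈ I, Function.Injective (d q))
    (hσ : ∀ q ∈ I, ∀ x : A, σ' q (θ x) = d q (σ q x) + ∑ j ∈ Finset.range q, u q j (σ j x))
    (h : ∀ x : A, (∀ q ∈ I, σ q x = 0) → x = 0) (x' : A') (hx' : ∀ q ∈ I, σ' q x' = 0) : x' = 0 := by
  obtain ⟨x, rfl⟩ := hθ x'
  rw [h x ((forall_mem_apply_eq_zero_iff_of_triangular θ d u hI hd hσ x).1 hx'), map_zero]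

/-- **Joint injectivity lifts along an injective comparison**: if `(σ′_q)_{q ∈ I}` is jointly injective
on `A′`, `θ : A → A′` is injective and `σ′` is a triangular re-expansion of `σ` through `θ` on the lower set
`I` (injectivity of the diagonal is not needed in this direction, but is kept for a uniform interface), then
`(σ_q)_{q ∈ I}` is jointly injective on `A`. [folklore] -/
theorem jointlyInjective_of_triangular_of_injective (θ : A →+ A') (hθ : Function.Injective θ)
    (d : ∀ q, W q →+ W' q) (u : ∀ q j, W j →+ W' q) {I : Set ℕ} (hI : IsLowerSet I)
    (hσ : ∀ q ∈ I, ∀ x : A, σ' q (θ x) = d q (σ q x) + ∑ j ∈ Finset.range q, u q j (σ j x))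
    (h : ∀ x' : A', (∀ q ∈ I, σ' q x' = 0) → x' = 0) (x : A) (hx : ∀ q ∈ I, σ q x = 0) : x = 0 := by
  refine hθ ((h (θ x) fun q hq => ?_).trans (map_zero θ).symm)
  rw [hσ q hq x, hx q hq, map_zero, zero_add]
  exact Finset.sum_eq_zero fun j hj => by rw [hx j (hI (Finset.mem_range.mp hj).le hq), map_zero]

/-- **Joint injectivity on a lower set is invariant under a triangular re-expansion with injective
diagonal along an additive bijection `θ : A ≃ A′`.** [folklore] -/
theorem jointlyInjective_iff_of_triangular (θ : A ≃+ A') (d : ∀ q, W q →+ W' q)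
    (u : ∀ q j, W j →+ W' q) {I : Set ℕ} (hI : IsLowerSet I)
    (hd : ∀ q ∈ I, Function.Injective (d q))
    (hσ : ∀ q ∈ I, ∀ x : A, σ' q (θ x) = d q (σ q x) + ∑ j ∈ Finset.range q, u q j (σ j x)) :
    (∀ x : A, (∀ q ∈ I, σ q x = 0) → x = 0) ↔ ∀ x' : A', (∀ q ∈ I, σ' q x' = 0) → x' = 0 :=
  ⟨jointlyInjective_of_triangular_of_surjective θ.toAddMonoidHom θ.surjective d u hI hd hσ,
    jointlyInjective_of_triangular_of_injective θ.toAddMonoidHom θ.injective d u hI hσ⟩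

end TriangularTransport

/-! ### The caveat: a single component is NOT transported -/

section Caveat

/-- **«Lower set» cannot be dropped: a single component `σ_q` is not transported by untwisting.** An
explicit UNItriangular re-expansion over `ℤ` — `A = A′ = W_q = W′_q = ℤ`, `θ = id`, `σ_q = id` for every
`q`, `u_{1,0} = -id` and all other `u_{q,j} = 0`, so that `σ′_0 = id`, `σ′_1 = σ_1 + u_{1,0} ∘ σ_0 = 0`,
`σ′_q = id` (`q ≥ 2`) — for which `σ_1` is injective while `σ′_1` is not: `{1}`-injectivity
(`IsHigherSemiregular`-type statements, `I = {1}` not a lower set) is not invariant, although by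
`jointlyInjective_iff_of_triangular` every lower-set statement is (gs-red RED-GS.md GS-23(b): the multiplier
`exp(∓c₁(L)) ∪` «MIXES the components σ_q: injectivity of a single σ_q is NOT transported»). [folklore] -/
theorem exists_unitriangular_not_transporting_singleton :
    ∃ (σ σ' : ∀ _q : ℕ, ℤ →+ ℤ) (u : ∀ _q _j : ℕ, ℤ →+ ℤ),
      (∀ (q : ℕ) (x : ℤ), σ' q x = σ q x + ∑ j ∈ Finset.range q, u q j (σ j x)) ∧
        (∀ x : ℤ, (∀ q ∈ ({1} : Set ℕ), σ q x = 0) → x = 0) ∧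
          ¬ ∀ x : ℤ, (∀ q ∈ ({1} : Set ℕ), σ' q x = 0) → x = 0 := by
  refine ⟨fun _ => AddMonoidHom.id ℤ, fun q => if q = 1 then 0 else AddMonoidHom.id ℤ,
    fun q j => if q = 1 ∧ j = 0 then -AddMonoidHom.id ℤ else 0, fun q x => ?_, fun x hx => ?_,
    fun h => ?_⟩
  · by_cases hq : q = 1
    · subst hq
      simp
    · simp only [hq, if_false, false_and, AddMonoidHom.id_apply, AddMonoidHom.zero_apply,
        Finset.sum_const_zero, add_zero]
  · simpa using hx 1 rfl
  · have h1 : (1 : ℤ) = 0 := h 1 fun q hq => by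
      rw [Set.mem_singleton_iff] at hq
      subst hq
      simp
    exact one_ne_zero h1

end Caveat

/-! ### Instantiation on the real carriers `σ_q = sigmaHigher hE q` -/

section Sigma

open Literature.AlgebraicGeometry.Motives Literature.AlgebraicGeometry.HodgeTheory

universe w w' u u'

variable {S : Type u} [CommRing S] {X : Over (Spec (CommRingCat.of S))} [HasExt.{w} X.left.Modules]
  {S' : Type u'} [CommRing S'] {X' : Over (Spec (CommRingCat.of S'))} [HasExt.{w'} X'.left.Modules]
  {E : X.left.Modules} {E' : X'.left.Modules} (hE : IsFiniteLocallyFree E) (hE' : IsFiniteLocallyFree E')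

/-- `IsISemiregular hE I` IS joint injectivity of `(σ_q)_{q ∈ I}` on `Ext²(E, E)` (definitional unfolding,
recorded so that the algebraic lemmas above apply verbatim). [cite: BuchweitzFlenner2003, §5 (I-semiregular)] -/
theorem isISemiregular_iff (I : Set ℕ) :
    IsISemiregular.{w} hE I ↔ ∀ x : Ext.{w} E E 2, (∀ q ∈ I, sigmaHigher hE q x = 0) → x = 0 :=
  Iff.rfl

/-- **Untwisting preserves `I`-semiregularity for every lower set `I` (route R1.0 (iii) / th-1 (T), kernel
clause, on real carriers).** Let `E` on `X/S` and `E′` on `X′/S′` be finite locally free,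
`θ : Ext²(E, E) ≃+ Ext²(E′, E′)` an additive bijection (intended: `ξ ↦ π^*ξ ⊗ 1_L`, R1.0 (i)),
`d_q : H^{q+2}(X, Ω^q) → H^{q+2}(X′, Ω^q)` injective (intended: `π^*`, or `id` when `X′ = X`) and `u_{q,j}`
arbitrary additive maps such that, for `q ∈ I`,
`σ_q^{E′}(θ ξ) = d_q (σ_q^{E} ξ) + Σ_{j<q} u_{q,j} (σ_j^{E} ξ)` (intended: the Leibniz rule
`At(F ⊗ M) = At(F) ⊗ 1 + 1 ⊗ c₁(M)`, Atiyah 1957 Prop. 10–11, giving `u_{q,j} = ±(q choose j)(c₁(M)^{q-j} ∪ –)`;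
in BF's normalisation the multiplier `exp(∓c₁(M)) ∪`). Then `E` is `I`-semiregular iff `E′` is, for every
LOWER set `I` of form degrees. [cite: BuchweitzFlenner2003, §5 (I-semiregular)] -/
theorem isISemiregular_iff_of_triangular (θ : Ext.{w} E E 2 ≃+ Ext.{w'} E' E' 2)
    (d : ∀ q, hodgeCohomology X q (q + 2) →+ hodgeCohomology X' q (q + 2))
    (u : ∀ q j, hodgeCohomology X j (j + 2) →+ hodgeCohomology X' q (q + 2))
    {I : Set ℕ} (hI : IsLowerSet I) (hd : ∀ q ∈ I, Function.Injective (d q))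
    (hσ : ∀ q ∈ I, ∀ x : Ext.{w} E E 2, sigmaHigher hE' q (θ x) =
      d q (sigmaHigher hE q x) + ∑ j ∈ Finset.range q, u q j (sigmaHigher hE j x)) :
    IsISemiregular.{w} hE I ↔ IsISemiregular.{w'} hE' I :=
  jointlyInjective_iff_of_triangular (σ := fun q => sigmaHigher hE q) (σ' := fun q => sigmaHigher hE' q)
    θ d u hI hd hσ

/-- **FULL semiregularity is preserved by untwisting** (`I = Set.univ`: all components `σ_q`, `q ≥ 0` —
the R1.0 clause «`σ_{E₀′}` injective iff `σ_{E₀}` is», FULL map, as gs-red GS-23(b) requires).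
[cite: BuchweitzFlenner2003, Def. 4.1 and §5] -/
theorem isISemiregular_univ_iff_of_triangular (θ : Ext.{w} E E 2 ≃+ Ext.{w'} E' E' 2)
    (d : ∀ q, hodgeCohomology X q (q + 2) →+ hodgeCohomology X' q (q + 2))
    (u : ∀ q j, hodgeCohomology X j (j + 2) →+ hodgeCohomology X' q (q + 2))
    (hd : ∀ q, Function.Injective (d q))
    (hσ : ∀ (q : ℕ) (x : Ext.{w} E E 2), sigmaHigher hE' q (θ x) =
      d q (sigmaHigher hE q x) + ∑ j ∈ Finset.range q, u q j (sigmaHigher hE j x)) :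
    IsISemiregular.{w} hE Set.univ ↔ IsISemiregular.{w'} hE' Set.univ :=
  isISemiregular_iff_of_triangular hE hE' θ d u isLowerSet_univ (fun q _ => hd q) fun q _ => hσ q

/-- **p-adic semiregularity (`I = {q | q < p}`) is preserved by untwisting** — `Set.Iio p` is a lower set;
only the components `q < p` of the Leibniz formula and of the diagonal are needed.
[cite: BuchweitzFlenner2003, §5 (I-semiregular)] -/
theorem isISemiregular_Iio_iff_of_triangular (p : ℕ) (θ : Ext.{w} E E 2 ≃+ Ext.{w'} E' E' 2)
    (d : ∀ q, hodgeCohomology X q (q + 2) →+ hodgeCohomology X' q (q + 2))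
    (u : ∀ q j, hodgeCohomology X j (j + 2) →+ hodgeCohomology X' q (q + 2))
    (hd : ∀ q < p, Function.Injective (d q))
    (hσ : ∀ q < p, ∀ x : Ext.{w} E E 2, sigmaHigher hE' q (θ x) =
      d q (sigmaHigher hE q x) + ∑ j ∈ Finset.range q, u q j (sigmaHigher hE j x)) :
    IsISemiregular.{w} hE (Set.Iio p) ↔ IsISemiregular.{w'} hE' (Set.Iio p) :=
  isISemiregular_iff_of_triangular hE hE' θ d u (isLowerSet_Iio p) (fun q hq => hd q hq) fun q hq => hσ q hq

/-- **One-sided transport, surjective comparison**: `I`-semiregularity of `E` and a SURJECTIVE additive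
`θ : Ext²(E, E) → Ext²(E′, E′)` intertwining the components triangularly (injective diagonal on `I`) give
`I`-semiregularity of `E′`, `I` a lower set. [cite: BuchweitzFlenner2003, §5 (I-semiregular)] -/
theorem isISemiregular_of_triangular_of_surjective (θ : Ext.{w} E E 2 →+ Ext.{w'} E' E' 2)
    (hθ : Function.Surjective θ)
    (d : ∀ q, hodgeCohomology X q (q + 2) →+ hodgeCohomology X' q (q + 2))
    (u : ∀ q j, hodgeCohomology X j (j + 2) →+ hodgeCohomology X' q (q + 2))
    {I : Set ℕ} (hI : IsLowerSet I) (hd : ∀ q ∈ I, Function.Injective (d q))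
    (hσ : ∀ q ∈ I, ∀ x : Ext.{w} E E 2, sigmaHigher hE' q (θ x) =
      d q (sigmaHigher hE q x) + ∑ j ∈ Finset.range q, u q j (sigmaHigher hE j x))
    (h : IsISemiregular.{w} hE I) : IsISemiregular.{w'} hE' I :=
  jointlyInjective_of_triangular_of_surjective (σ := fun q => sigmaHigher hE q)
    (σ' := fun q => sigmaHigher hE' q) θ hθ d u hI hd hσ h

/-- **One-sided transport, injective comparison**: `I`-semiregularity of `E′` and an INJECTIVE additive
`θ : Ext²(E, E) → Ext²(E′, E′)` intertwining the components triangularly give `I`-semiregularity of `E`,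
`I` a lower set (no injectivity of the diagonal needed). [cite: BuchweitzFlenner2003, §5 (I-semiregular)] -/
theorem isISemiregular_of_triangular_of_injective (θ : Ext.{w} E E 2 →+ Ext.{w'} E' E' 2)
    (hθ : Function.Injective θ)
    (d : ∀ q, hodgeCohomology X q (q + 2) →+ hodgeCohomology X' q (q + 2))
    (u : ∀ q j, hodgeCohomology X j (j + 2) →+ hodgeCohomology X' q (q + 2))
    {I : Set ℕ} (hI : IsLowerSet I)
    (hσ : ∀ q ∈ I, ∀ x : Ext.{w} E E 2, sigmaHigher hE' q (θ x) =
      d q (sigmaHigher hE q x) + ∑ j ∈ Finset.range q, u q j (sigmaHigher hE j x))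
    (h : IsISemiregular.{w'} hE' I) : IsISemiregular.{w} hE I :=
  jointlyInjective_of_triangular_of_injective (σ := fun q => sigmaHigher hE q)
    (σ' := fun q => sigmaHigher hE' q) θ hθ d u hI hσ h

/-- **The direction route R1.0 consumes, FULL map**: if `E` (intended `E₀` on `X₀`) is fully semiregular
(`(σ_q)_{q ≥ 0}` jointly injective), `θ : Ext²(E, E) → Ext²(E′, E′)` is surjective (intended: the
identification `ξ ↦ π^*ξ ⊗ 1_L` of R1.0 (i)), the diagonal maps `d_q` are injective (intended `π^*` on Hodge
cohomology) and the components of `E′` (intended `E₀′ = π^*E₀ ⊗ L^{∓1}`) are the triangular re-expansion of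
those of `E` (the Leibniz rule), then `E′` is fully semiregular. [cite: BuchweitzFlenner2003, Def. 4.1 and §5] -/
theorem isISemiregular_univ_of_triangular_of_surjective (θ : Ext.{w} E E 2 →+ Ext.{w'} E' E' 2)
    (hθ : Function.Surjective θ)
    (d : ∀ q, hodgeCohomology X q (q + 2) →+ hodgeCohomology X' q (q + 2))
    (u : ∀ q j, hodgeCohomology X j (j + 2) →+ hodgeCohomology X' q (q + 2))
    (hd : ∀ q, Function.Injective (d q))
    (hσ : ∀ (q : ℕ) (x : Ext.{w} E E 2), sigmaHigher hE' q (θ x) =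
      d q (sigmaHigher hE q x) + ∑ j ∈ Finset.range q, u q j (sigmaHigher hE j x))
    (h : IsISemiregular.{w} hE Set.univ) : IsISemiregular.{w'} hE' Set.univ :=
  isISemiregular_of_triangular_of_surjective hE hE' θ hθ d u isLowerSet_univ (fun q _ => hd q)
    (fun q _ => hσ q) h

end Sigma

section SameScheme

open Literature.AlgebraicGeometry.Motives Literature.AlgebraicGeometry.HodgeTheory

universe w u

variable {S : Type u} [CommRing S] {X : Over (Spec (CommRingCat.of S))} [HasExt.{w} X.left.Modules]
  {E E' : X.left.Modules} (hE : IsFiniteLocallyFree E) (hE' : IsFiniteLocallyFree E')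

/-- **Same scheme, UNItriangular re-expansion** (`X′ = X`, `d_q = id`): the untwisted reading of the
STEP-0 component (`E′ = E₀ ⊗ M_B` on `X₀` itself, `θ = - ⊗ 1_{M_B}`,
`σ_q^{E′}(θ ξ) = σ_q^E ξ + Σ_{j<q} u_{q,j}(σ_j^E ξ)`): `E` is `I`-semiregular iff `E′` is, for every lower
set `I`. [cite: BuchweitzFlenner2003, §5 (I-semiregular)] -/
theorem isISemiregular_iff_of_unitriangular (θ : Ext.{w} E E 2 ≃+ Ext.{w} E' E' 2)
    (u : ∀ q j, hodgeCohomology X j (j + 2) →+ hodgeCohomology X q (q + 2))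
    {I : Set ℕ} (hI : IsLowerSet I)
    (hσ : ∀ q ∈ I, ∀ x : Ext.{w} E E 2, sigmaHigher hE' q (θ x) =
      sigmaHigher hE q x + ∑ j ∈ Finset.range q, u q j (sigmaHigher hE j x)) :
    IsISemiregular.{w} hE I ↔ IsISemiregular.{w} hE' I :=
  isISemiregular_iff_of_triangular hE hE' θ (fun q => AddMonoidHom.id _) u hI
    (fun _ _ => Function.injective_id) fun q hq x => by rw [hσ q hq x, AddMonoidHom.id_apply]

end SameScheme

section LowerSetCharacterisation

/-- **For every NON-lower index set the transport fails**: if some `b ∈ I` has an `a < b` with `a ∉ I`,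
the UNItriangular re-expansion over `ℤ` with `σ_a = σ_b = id` (other `σ_q = 0`), `u_{b,a} = -id` (other
`u = 0`) has `(σ_q)_{q ∈ I}` jointly injective and `(σ′_q)_{q ∈ I} = 0`: the missing lower component `σ_a`
cancels `σ_b` (`I = {1}`: `exists_unitriangular_not_transporting_singleton`). [folklore] -/
theorem exists_unitriangular_not_transporting_of_not_isLowerSet {I : Set ℕ} (hI : ¬ IsLowerSet I) :
    ∃ (σ σ' : ∀ _q : ℕ, ℤ →+ ℤ) (u : ∀ _q _j : ℕ, ℤ →+ ℤ),
      (∀ (q : ℕ) (x : ℤ), σ' q x = σ q x + ∑ j ∈ Finset.range q, u q j (σ j x)) ∧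
        (∀ x : ℤ, (∀ q ∈ I, σ q x = 0) → x = 0) ∧
          ¬ ∀ x : ℤ, (∀ q ∈ I, σ' q x = 0) → x = 0 := by
  simp only [IsLowerSet, not_forall, exists_prop] at hI
  obtain ⟨b, a, hab, hb, ha⟩ := hI
  have hab' : a < b := lt_of_le_of_ne hab (by rintro rfl; exact ha hb)
  classical
  refine ⟨fun q => if q = b ∨ q = a then AddMonoidHom.id ℤ else 0,
    fun q => if q = b then 0 else if q = a then AddMonoidHom.id ℤ else 0,
    fun q j => if q = b ∧ j = a then -AddMonoidHom.id ℤ else 0, fun q x => ?_,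
    fun x hx => by simpa using hx b hb, fun h => one_ne_zero (h 1 fun q hq => ?_)⟩
  · by_cases hqb : q = b
    · subst hqb
      simp only [if_true, true_or, true_and, AddMonoidHom.zero_apply, AddMonoidHom.id_apply]
      rw [Finset.sum_eq_single a (fun j _ hj => by simp [hj])
        fun h => absurd (Finset.mem_range.mpr hab') h]
      simp
    · by_cases hqa : q = a
      · subst hqa
        simp [hqb]
      · simp [hqb, hqa]
  · have hqa : q ≠ a := fun hqa => ha (hqa ▸ hq)
    by_cases hqb : q = b
    · subst hqb
      simp
    · simp [hqb, hqa]

/-- **`I ⊆ ℕ` is a lower set iff joint injectivity on `I` is invariant under EVERY unitriangular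
re-expansion** (`ℤ`-valued families; `⇒` = `jointlyInjective_iff_of_triangular` with `θ = id`, `d = id`,
`⇐` = `exists_unitriangular_not_transporting_of_not_isLowerSet`): FULL `σ`, the p-adic parts `{q | q < p}`
and the initial segments `{q | q ≤ n}` (and `∅`) are exactly the parts of the semiregularity map whose
injectivity the triangular shape of untwisting is guaranteed to preserve. [folklore] -/
theorem isLowerSet_iff_forall_unitriangular_transport (I : Set ℕ) :
    IsLowerSet I ↔ ∀ (σ σ' : ∀ _q : ℕ, ℤ →+ ℤ) (u : ∀ _q _j : ℕ, ℤ →+ ℤ),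
      (∀ (q : ℕ) (x : ℤ), σ' q x = σ q x + ∑ j ∈ Finset.range q, u q j (σ j x)) →
        ((∀ x : ℤ, (∀ q ∈ I, σ q x = 0) → x = 0) ↔ ∀ x : ℤ, (∀ q ∈ I, σ' q x = 0) → x = 0) := by
  refine ⟨fun hI σ σ' u hσ => jointlyInjective_iff_of_triangular (AddEquiv.refl ℤ)
    (fun _ => AddMonoidHom.id ℤ) u hI (fun _ _ => Function.injective_id) fun q _ x => hσ q x, fun h => ?_⟩
  by_contra hI
  obtain ⟨σ, σ', u, hσ, hinj, hnot⟩ := exists_unitriangular_not_transporting_of_not_isLowerSet hI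
  exact hnot ((h σ σ' u hσ).1 hinj)

end LowerSetCharacterisation

end Summit.Ventures.HSemireg
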